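import Summits.SmoothPoincare4.SmoothPoincare4.Theses.InformationMetricHadamard

/-!
# Lead's sketch of a skeleton for idea `core-distance-morse` (crux `InformationMetricHadamard.C0AhRecognition`)

NOT a line (no crux-plan has run); input for crux-plan from the line lead of `Sketch`, who assessed the
idea in `Cruxes/C0AhRecognition/NOTES.md` (§2 and addenda). Three stubs + a kernel-checked composition:

* `stub_nearestPointSpread` (N; M): the √2-spread of nearest points on the far core `K_s`, from the
  crux's C⁰ clause alone (Minkowski argument of NOTES.md 15:50Z; real-analysis core already checked in
  `PrepNearestPointSpread.lean`). Uses far immersivity (stub A of line Sketch, LANDED p110749) only to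
  know `frontier K_s = Φ(Σ × {s})`.
* `stub_subcriticalEndSphere` (E; XL, to be split by the lead of that line into field / flow / radial
  graph): a Cartan–Hadamard 5-manifold with a proper smooth injective end collar over a homotopy
  4-sphere, immersive below level `t₀`, whose far core `K_s` (some `s < t₀`) has the √2-spread property,
  has cross-section `≅ S⁴` (Grove–Shiohama for `d(·,K_s)` in the Hadamard setting: `exp⁻¹` 1-Lipschitz
  gives the angles, Danskin gives monotonicity, the collar field serves the near end, `∇r` the far end,
  6016's landed radial machinery the sphere).
* composition `C0AhRecognition_of'` : N + E + stub A ⊢ the crux BY NAME.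
-/

noncomputable section

-- the prescribed namespace `Summit.<P>.<Sub>.…` duplicates `SmoothPoincare4` (P = Sub)
set_option linter.dupNamespace false

open scoped Manifold ContDiff Topology ENNReal NNReal
open Set Function

namespace Summit.SmoothPoincare4.SmoothPoincare4.Cruxes.C0AhRecognition.CoreDistanceMorseLead

open Literature.Topology.FourManifolds (HomotopySphere)
open Literature.Geometry.Lorentzian (PseudoRiemannianMetric)


/-- COPY of the LANDED stub A of line Sketch (tree: `Theorems/InformationMetricHadamardC0AhRecognitionStubFarCollarImmersive.lean`,
p110749, proved). Kept as a sorried copy only because the farm had not rebuilt that module when this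
sketch was checked; a line skeleton should `import` it and delete this copy. -/
theorem stub_farCollarImmersive_copy
    (N : Type) [TopologicalSpace N] [ChartedSpace (EuclideanSpace ℝ (Fin 4)) N] [IsManifold (𝓡 4) ∞ N]
    (gN : PseudoRiemannianMetric (𝓡 4) ∞ (EuclideanSpace ℝ (Fin 4)) (TangentSpace (𝓡 4) : N → Type _))
    (hgN : gN.IsRiemannian)
    (W : Type) [TopologicalSpace W] [ChartedSpace (EuclideanSpace ℝ (Fin 5)) W] [IsManifold (𝓡 5) ∞ W]
    (G : PseudoRiemannianMetric (𝓡 5) ∞ (EuclideanSpace ℝ (Fin 5)) (TangentSpace (𝓡 5) : W → Type _))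
    (c : ℝ) (Ψ : N × ℝ → W) (hc : 0 < c)
    (hasym : ∀ ε : ℝ, 0 < ε → ∃ t ∈ Ioo (0 : ℝ) 1, ∀ (y : N) (l : ℝ), l ∈ Ioo (0 : ℝ) t →
      ∀ (v : TangentSpace (𝓡 4) y) (s : ℝ),
        |G.val (Ψ (y, l)) (mfderiv ((𝓡 4).prod 𝓘(ℝ, ℝ)) (𝓡 5) Ψ (y, l) (v, s))
            (mfderiv ((𝓡 4).prod 𝓘(ℝ, ℝ)) (𝓡 5) Ψ (y, l) (v, s)) -
          c * (s ^ 2 + gN.val y v v) / l ^ 2| ≤ ε * (c * (s ^ 2 + gN.val y v v) / l ^ 2)) :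
    ∃ t ∈ Ioo (0 : ℝ) 1, ∀ (y : N) (l : ℝ), l ∈ Ioo (0 : ℝ) t →
      Injective (mfderiv ((𝓡 4).prod 𝓘(ℝ, ℝ)) (𝓡 5) Ψ (y, l)) := by
  sorry

/-! ## Stub N — nearest-point spread on the far cores -/

/-- **Stub N (`NearestPointSpread`).** Under the collar clauses of the crux (smooth injective collar,
closure clause, C⁰-asymptotics with `c > 0`, `g` and `G` Riemannian) there is `t ∈ (0,1)` such that for
every `s < t`, every deep point `y ∈ Φ(Σ × (0,s))` and every two nearest points `k₁, k₂` of `y` on the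
far core `K_s = (Φ(Σ × (0,s)))ᶜ`, `d_G(k₁,k₂) < √2 · d_G(y, K_s)`. Proof (NOTES.md 15:50Z): with
`ε = 1/20`, `r² = 21/19`, minimising paths from `y = Φ(x₀,λ₀)` to `K_s` stay below level `s`, so by
the length sandwich and Minkowski their feet lie within `g`-distance `s√(r²−1)·log(s/λ₀)` of `x₀`; the
level-`s` path between the feet then gives `d_G(k₁,k₂) ≤ 2r√(r²−1)·d_G(y,K_s)` and
`2r√(r²−1) = 0.68… < √2` (`PrepNearestPointSpread.two_mul_r_sqrt_lt_sqrt_two`). -/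
theorem stub_nearestPointSpread
    (S : HomotopySphere 4)
    (g : PseudoRiemannianMetric (𝓡 4) ∞ (EuclideanSpace ℝ (Fin 4)) (TangentSpace (𝓡 4) : S.carrier → Type _))
    (hg : g.IsRiemannian)
    (W : Type) [TopologicalSpace W] [T2Space W] [SecondCountableTopology W]
    [ChartedSpace (EuclideanSpace ℝ (Fin 5)) W] [IsManifold (𝓡 5) ∞ W]
    (G : PseudoRiemannianMetric (𝓡 5) ∞ (EuclideanSpace ℝ (Fin 5)) (TangentSpace (𝓡 5) : W → Type _))
    (hG : G.IsRiemannian) (c : ℝ) (Φ : S.carrier × ℝ → W) (hc : 0 < c)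
    (hsm : ContMDiffOn ((𝓡 4).prod 𝓘(ℝ, ℝ)) (𝓡 5) ∞ Φ (univ ×ˢ Ioo (0 : ℝ) 1))
    (hinj : InjOn Φ (univ ×ˢ Ioo (0 : ℝ) 1))
    (hcl : ∀ t ∈ Ioo (0 : ℝ) 1, closure (Φ '' (univ ×ˢ Ioo (0 : ℝ) t)) ⊆ Φ '' (univ ×ˢ Ioo (0 : ℝ) 1))
    (hasym : ∀ ε : ℝ, 0 < ε → ∃ t ∈ Ioo (0 : ℝ) 1, ∀ (x : S.carrier) (l : ℝ), l ∈ Ioo (0 : ℝ) t →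
      ∀ (v : TangentSpace (𝓡 4) x) (s : ℝ),
        |G.val (Φ (x, l)) (mfderiv ((𝓡 4).prod 𝓘(ℝ, ℝ)) (𝓡 5) Φ (x, l) (v, s))
            (mfderiv ((𝓡 4).prod 𝓘(ℝ, ℝ)) (𝓡 5) Φ (x, l) (v, s)) -
          c * (s ^ 2 + g.val x v v) / l ^ 2| ≤ ε * (c * (s ^ 2 + g.val x v v) / l ^ 2)) :
    ∃ t ∈ Ioo (0 : ℝ) 1, ∀ s ∈ Ioo (0 : ℝ) t, ∀ y ∈ Φ '' (univ ×ˢ Ioo (0 : ℝ) s),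
      ∀ k₁ ∈ (Φ '' (univ ×ˢ Ioo (0 : ℝ) s))ᶜ, ∀ k₂ ∈ (Φ '' (univ ×ˢ Ioo (0 : ℝ) s))ᶜ,
        G.edist hG y k₁ = ⨅ k ∈ (Φ '' (univ ×ˢ Ioo (0 : ℝ) s))ᶜ, G.edist hG y k →
        G.edist hG y k₂ = ⨅ k ∈ (Φ '' (univ ×ˢ Ioo (0 : ℝ) s))ᶜ, G.edist hG y k →
        G.edist hG k₁ k₂ <
          ENNReal.ofReal (Real.sqrt 2) * ⨅ k ∈ (Φ '' (univ ×ˢ Ioo (0 : ℝ) s))ᶜ, G.edist hG y k := by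
  sorry

/-! ## Stub E — a subcritical end of a Cartan–Hadamard 5-manifold has spherical cross-section -/

/-- **Stub E (`SubcriticalEndSphere`, the engine in collar form).** Let `(W, G)` be Cartan–Hadamard
(complete, simply connected, `sec ≤ 0`), `Φ : Σ × (0,1) → W` a smooth injective end collar over a
homotopy 4-sphere with co-compact far parts and the closure clause, immersive on `Σ × (0,t₀)`, and let
`s < t₀` be a level whose far core `K_s = (Φ(Σ × (0,s)))ᶜ` has the √2-spread property of stub N. Then
`Σ ≅ S⁴`. Mechanism: `f = d(·,K_s)` is Grove–Shiohama-regular on `W ∖ K_s` (√2-spread + `exp_y⁻¹`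
1-Lipschitz ⇒ minimising directions pairwise at angle `< π/2`; far out the law of cosines makes `∇r`
regular); a smooth complete field `X` with `f` increasing along `X`, equal to the collar field
`Φ_*(−∂_λ)` next to `N_s = Φ(Σ × {s})` (near-field transversality) and to `∇r` far out, flows the slice
`N_s ≅ Σ` onto a smooth radial graph over the unit sphere at `o`, which is `≅ S⁴` (item 6016's radial
machinery). Grove–Shiohama, Ann. of Math. 106 (1977); Petersen, Riemannian Geometry, 3rd ed., §12.1. -/
theorem stub_subcriticalEndSphere
    (S : HomotopySphere 4)
    (W : Type) [TopologicalSpace W] [T2Space W] [SecondCountableTopology W]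
    [ChartedSpace (EuclideanSpace ℝ (Fin 5)) W] [IsManifold (𝓡 5) ∞ W] [SimplyConnectedSpace W]
    (G : PseudoRiemannianMetric (𝓡 5) ∞ (EuclideanSpace ℝ (Fin 5)) (TangentSpace (𝓡 5) : W → Type _))
    (hG : G.IsRiemannian) (Φ : S.carrier × ℝ → W)
    (hcpt : ∀ (x : W) (r : NNReal), IsCompact {y : W | G.edist hG x y ≤ r})
    (hsec : ∀ cov, G.IsLeviCivita cov →
      ∀ (x : W) (X Y : TangentSpace (𝓡 5) x), G.sectionalCurvature cov x X Y ≤ 0)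
    (hsm : ContMDiffOn ((𝓡 4).prod 𝓘(ℝ, ℝ)) (𝓡 5) ∞ Φ (univ ×ˢ Ioo (0 : ℝ) 1))
    (hinj : InjOn Φ (univ ×ˢ Ioo (0 : ℝ) 1))
    (hco : ∀ t ∈ Ioo (0 : ℝ) 1, IsCompact (Φ '' (univ ×ˢ Ioo (0 : ℝ) t))ᶜ)
    (hcl : ∀ t ∈ Ioo (0 : ℝ) 1, closure (Φ '' (univ ×ˢ Ioo (0 : ℝ) t)) ⊆ Φ '' (univ ×ˢ Ioo (0 : ℝ) 1))
    (t₀ : ℝ) (ht₀ : t₀ ∈ Ioo (0 : ℝ) 1)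
    (himm : ∀ (x : S.carrier) (l : ℝ), l ∈ Ioo (0 : ℝ) t₀ →
      Injective (mfderiv ((𝓡 4).prod 𝓘(ℝ, ℝ)) (𝓡 5) Φ (x, l)))
    (s : ℝ) (hs : s ∈ Ioo (0 : ℝ) t₀)
    (hspread : ∀ y ∈ Φ '' (univ ×ˢ Ioo (0 : ℝ) s),
      ∀ k₁ ∈ (Φ '' (univ ×ˢ Ioo (0 : ℝ) s))ᶜ, ∀ k₂ ∈ (Φ '' (univ ×ˢ Ioo (0 : ℝ) s))ᶜ,
        G.edist hG y k₁ = ⨅ k ∈ (Φ '' (univ ×ˢ Ioo (0 : ℝ) s))ᶜ, G.edist hG y k →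
        G.edist hG y k₂ = ⨅ k ∈ (Φ '' (univ ×ˢ Ioo (0 : ℝ) s))ᶜ, G.edist hG y k →
        G.edist hG k₁ k₂ <
          ENNReal.ofReal (Real.sqrt 2) * ⨅ k ∈ (Φ '' (univ ×ˢ Ioo (0 : ℝ) s))ᶜ, G.edist hG y k) :
    Nonempty (S.carrier ≃ₘ⟮𝓡 4, 𝓡 4⟯ (Metric.sphere (0 : EuclideanSpace ℝ (Fin 5)) 1)) := by
  sorry

/-! ## Composition (kernel-checked; no `sorry` of its own) -/

/-- **The sketch concludes the crux BY NAME.** Far immersivity (stub A of line Sketch, landed) gives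
`t₀`; stub N gives the spread below some `t`; stub E at a level `s < min t₀ t` gives `Σ ≅ S⁴`. -/
theorem C0AhRecognition_of' :
    Summit.SmoothPoincare4.SmoothPoincare4.Theses.InformationMetricHadamard.C0AhRecognition := by
  intro S g hg W _ _ _ _ _ _ G hG c Φ hc hcpt hsec hsm hinj hco hcl hasym
  obtain ⟨t₀, ht₀, himm⟩ :=
    stub_farCollarImmersive_copy
      S.carrier g hg W G c Φ hc hasym
  obtain ⟨t, ht, hN⟩ := stub_nearestPointSpread S g hg W G hG c Φ hc hsm hinj hcl hasym
  -- a level below both thresholds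
  set s : ℝ := min t₀ t / 2 with hs_def
  have hmin : 0 < min t₀ t := lt_min ht₀.1 ht.1
  have hs0 : 0 < s := by rw [hs_def]; linarith
  have hst₀ : s < t₀ := by
    rw [hs_def]; linarith [min_le_left t₀ t]
  have hst : s < t := by
    rw [hs_def]; linarith [min_le_right t₀ t]
  exact stub_subcriticalEndSphere S W G hG Φ hcpt hsec hsm hinj hco hcl t₀ ht₀ himm s ⟨hs0, hst₀⟩
    (hN s ⟨hs0, hst⟩)

end Summit.SmoothPoincare4.SmoothPoincare4.Cruxes.C0AhRecognition.CoreDistanceMorseLead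

end
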